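import Mathlib
import Summits.KontsevichZagierPeriods.KontsevichZagierPeriods.Theses.InverseLandau

/-!
# `TateLifting`, line `Sketch`, stub `stub_cornerShift` — corner shift by a primitive element

Crux stmt-KontsevichZagierPeriods-9129 (`Summit.KontsevichZagierPeriods.KontsevichZagierPeriods.Theses.InverseLandau.TateLifting`).
Finitely many real-algebraic numbers `a j` are `ℚ`-polynomial expressions in ONE real-algebraic
`θ > 0` whose minimal polynomial has no root in `(0, θ)`: primitive element theorem for
`ℚ(a₁,…,a_k) ⊆ ℝ` (finite-dimensional, characteristic `0`), then a rational shift `θ = θ₀ − c` with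
`c ∈ ℚ` strictly between `θ₀` and every smaller real conjugate of `θ₀` (roots of `minpoly ℚ θ` are
roots of `(minpoly ℚ θ₀).comp (X + C c)` since the former divides the latter).
-/

noncomputable section

namespace Summit.KontsevichZagierPeriods.InverseLandau

open Literature.NumberTheory.Transcendental
open Polynomial

/-- **Primitive element, polynomial form**: finitely many real-algebraic numbers `a j` are
`ℚ`-polynomial expressions in a single real-algebraic number `θ₀`, namely a primitive element of the
finite (hence, in characteristic `0`, separable) extension `ℚ(a₁,…,a_k) ⊆ ℝ` of `ℚ`. [folklore] -/
theorem tateLifting_cornerShift_generator {k : ℕ} (a : Fin k → ℝ)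
    (ha : ∀ j, IsAlgebraic ℚ (a j)) :
    ∃ θ₀ : ℝ, IsAlgebraic ℚ θ₀ ∧ ∀ j, ∃ q : ℚ[X], aeval θ₀ q = a j := by
  set K₀ : IntermediateField ℚ ℝ := IntermediateField.adjoin ℚ (Set.range a)
  haveI : FiniteDimensional ℚ K₀ :=
    IntermediateField.finiteDimensional_adjoin fun x hx => by
      obtain ⟨j, rfl⟩ := hx
      exact (ha j).isIntegral
  obtain ⟨α, hα⟩ := Field.exists_primitive_element ℚ K₀
  have hsurj : Function.Surjective (aeval (R := ℚ) α) := by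
    rw [← AlgHom.range_eq_top, ← Algebra.adjoin_singleton_eq_range_aeval,
      ← IntermediateField.adjoin_simple_toSubalgebra_of_isAlgebraic
        (Algebra.IsAlgebraic.isAlgebraic α), hα, IntermediateField.top_toSubalgebra]
  refine ⟨(α : ℝ), IntermediateField.isAlgebraic_iff.mp (Algebra.IsAlgebraic.isAlgebraic α),
    fun j => ?_⟩
  have hj : a j ∈ K₀ := IntermediateField.subset_adjoin ℚ (Set.range a) ⟨j, rfl⟩
  obtain ⟨q, hq⟩ := hsurj ⟨a j, hj⟩
  refine ⟨q, ?_⟩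
  rw [IntermediateField.aeval_coe]
  exact congrArg Subtype.val hq

/-- **Rational isolation from the smaller roots**: for a nonzero `p ∈ ℚ[X]` and a real `x` there is
a rational `c < x` exceeding every real root of `p` smaller than `x` (the real roots of `p` form a
finite set, and `ℚ` is dense in `ℝ`). [folklore] -/
theorem tateLifting_cornerShift_ratGap {p : ℚ[X]} (hp : p ≠ 0) (x : ℝ) :
    ∃ c : ℚ, (c : ℝ) < x ∧ ∀ r : ℝ, aeval r p = 0 → r < x → r < c := by
  classical
  set S : Finset ℝ := (p.rootSet_finite ℝ).toFinset.filter (· < x)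
  have hne : (insert (x - 1) S).Nonempty := Finset.insert_nonempty _ _
  have hb : (insert (x - 1) S).max' hne < x := by
    rcases Finset.mem_insert.mp (Finset.max'_mem _ hne) with h | h
    · rw [h]
      linarith
    · exact (Finset.mem_filter.mp h).2
  obtain ⟨c, hbc, hcx⟩ := exists_rat_btwn hb
  refine ⟨c, hcx, fun r hr hrx => lt_of_le_of_lt (Finset.le_max' _ r ?_) hbc⟩
  rw [Finset.mem_insert]
  right
  rw [Finset.mem_filter, Set.Finite.mem_toFinset, Polynomial.mem_rootSet]
  exact ⟨⟨hp, hr⟩, hrx⟩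

/-- **Roots of a shifted minimal polynomial**: for `c ∈ ℚ`, every real root `t` of
`minpoly ℚ (θ₀ - c)` yields the real root `t + c` of `minpoly ℚ θ₀`, because `minpoly ℚ (θ₀ - c)`
divides `(minpoly ℚ θ₀).comp (X + C c)`. [folklore] -/
theorem tateLifting_cornerShift_rootShift {θ₀ t : ℝ} {c : ℚ}
    (ht : aeval t (minpoly ℚ (θ₀ - c)) = 0) : aeval (t + c) (minpoly ℚ θ₀) = 0 := by
  have hdvd : minpoly ℚ (θ₀ - (c : ℝ)) ∣ (minpoly ℚ θ₀).comp (X + C c) := by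
    refine minpoly.dvd ℚ (θ₀ - (c : ℝ)) ?_
    rw [aeval_comp]
    simp
  obtain ⟨g, hg⟩ := hdvd
  have h := congrArg (aeval t) hg
  rw [aeval_comp, map_mul, ht, zero_mul] at h
  simpa using h

/-- **Corner shift** (stub `stub_cornerShift` of line `Sketch` for crux `TateLifting`): for
real-algebraic `a₁, …, a_k` there is a real-algebraic `θ > 0` whose minimal polynomial over `ℚ` has
no root in `(0, θ)` and with every `a j ∈ ℚ[θ]`. [folklore] -/
theorem tateLifting_cornerShift :
    ∀ (k : ℕ) (a : Fin k → ℝ), (∀ j, IsAlgebraic ℚ (a j)) →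
      ∃ θ : ℝ, IsAlgebraic ℚ θ ∧ 0 < θ ∧
        (∀ t ∈ Set.Ioo (0 : ℝ) θ, Polynomial.aeval t (minpoly ℚ θ) ≠ 0) ∧
        ∀ j, ∃ q : Polynomial ℚ, Polynomial.aeval θ q = a j := by
  intro k a ha
  obtain ⟨θ₀, hθ₀, hgen⟩ := tateLifting_cornerShift_generator a ha
  obtain ⟨c, hc, hroots⟩ := tateLifting_cornerShift_ratGap (minpoly.ne_zero hθ₀.isIntegral) θ₀
  refine ⟨θ₀ - c, hθ₀.sub (isAlgebraic_algebraMap c), sub_pos.mpr hc, ?_, fun j => ?_⟩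
  · rintro t ⟨ht0, htθ⟩ ht
    have h1 := hroots (t + c) (tateLifting_cornerShift_rootShift ht) (by linarith)
    linarith
  · obtain ⟨q, hq⟩ := hgen j
    refine ⟨q.comp (X + C c), ?_⟩
    rw [aeval_comp]
    simpa using hq

end Summit.KontsevichZagierPeriods.InverseLandau

end
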